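import Summits.ResolutionOfSingularities.ResolutionOfSingularities.Theorems.UniversalCellsCampaignW82SelectionWitness
import Literature.AlgebraicGeometry.Resolution.SmoothStalksRegular
import Literature.AlgebraicGeometry.Resolution.ProjectiveSpaceRegular
import Summits.ResolutionOfSingularities.ResolutionOfSingularities.Theorems.UniversalCellsCampaignW82ExponentZeroGraded
import HarnessLib

/-!
# [OURS · L1 W8.2] SELECTION IS NECESSARY, II — a resolution of the SMOOTH plane `𝔸²_{k(t)}` that is NOT smooth
# over `k(t)` (every field `k` of characteristic `p`)

Cell `res-hironaka`, LADDER-RESOLUTION rung L, slot W8.2 (host `UniversalCells.PrimeFieldToPerfect`, stmt-15233; door 2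
`UniformComplexity.PrimeModelTransfer`, stmt-8933). Proofs (Theses-free) by res-L1-s82-pv-1 (gen 3), on the objects
of Theorems/UniversalCellsCampaignW82SelectionWitness.lean.

WHAT IS PROVED (everything a theorem; no `sorry`, no new axioms):
* the cusp of the chart after `t ↦ t^{1/p}`: `chartPolyExt = Y T − (X^p − s^p)` over `K = k(t)(t^{1/p})` vanishes with
  all its partials at `(T, Y, X) = (0, 0, s)` (`p = 0` in `K`), so `K[T,Y,X]/(chartPolyExt)` is NOT regular there
  (`not_isRegularLocalRing_chartCuspIdeal`; Jacobian criterion, tree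
  `not_isRegularLocalRing_localization_of_pderiv_eval_eq_zero`);
* **`not_smooth_blowupπ`**: the blow-up `Bl ⟶ 𝔸²_{k(t)} ⟶ Spec k(t)` of the plane at `(Y, X^p − t)` is NOT smooth
  (`k` any field of characteristic `p`): restricted to the chart `Spec (R[It])_{(Yt)} ≅ Spec k(t)[T,Y,X]/(Y T − (X^p − t))`
  (Mathlib `Proj.awayι`, tree `affineBlowup.awayι_reesT_π`, `chartIso`) it would be smooth, hence its base change to
  `K` regular (Stacks 056S) — contradicting the cusp;
* `smooth_plane` (`𝔸²_{k(t)} ⟶ Spec k(t)` is smooth) and the headline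
  **`exists_resolution_of_smooth_not_smooth`**: over `k(t)`, for every field `k` of characteristic `p`, there are a
  SMOOTH integral separated surface `X₀` of finite type and a resolution of singularities `π : X₁ ⟶ X₀` (`IsResolution`:
  proper, birational, `X₁` regular) with `X₁ ⟶ Spec k(t)` NOT smooth.

WHAT THIS SAYS FOR THE SLOT (honest grade). A tightness certificate for the residual's normal form, complementary to
the exponent certificates (…ExponentZeroProofs/AnyField): in «SOME Frobenius twist has SOME proper birational model
smooth over the ground field» (`CampaignW82.HasSmoothFrobeniusTwistModel`), the model must be SELECTED — «every
resolution of the twist» is false already when the twist is the smooth plane (`e = 0`, `X₀ = 𝔸²`). Existence-only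
resolution over `k(t)` (the crux's hypothesis after spreading out) does not control smoothness: this is STRATEGY-CENSUS
N2 (iii) / Disproof §4 (s5) at one step, kernel-checked. Nothing here bears on the open residual `n ≥ 4` itself.

HONEST FRAMING. OURS campaign theorems (role replaced: §17 ¶2 p.89 l.59–62 of [Hironaka2017], «reformulate over the
prime field and climb», typed AS PRINTED as `S17Methodology.U89_3`); NOT statements of the manuscript; nothing
attributed to its author; no typed candidate used. AI work, weaker than expert review.

## References (locators)
* J. Kollár, *Lectures on Resolution of Singularities* (2007), 1.19. [Kollar2007]
* Q. Liu, *Algebraic Geometry and Arithmetic Curves* (2002), Thm. 8.1.19 (a), Cor. 4.3.33/Rem. 4.3.34. [Liu2002]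
* R. Hartshorne, *Algebraic Geometry* (1977), I Thm. 5.1 (Jacobian criterion). [Hartshorne1977]
* The Stacks Project, Tag 056S (smooth over a field ⇒ regular). [StacksProject]
* Cruxes/PrimeFieldToPerfect/STRATEGY-CENSUS.md N2; Disproof.lean §4 (s5); KERNEL.md §3 — cell files, OURS.
-/

noncomputable section

set_option linter.dupNamespace false -- mandated namespace of this single-conjunct summit

open Polynomial IsLocalRing TensorProduct Pointwise
open _root_.CategoryTheory _root_.CategoryTheory.Limits _root_.AlgebraicGeometry
open Literature.AlgebraicGeometry.Resolution

namespace Summit.ResolutionOfSingularities.ResolutionOfSingularities.Theorems.CampaignW82.SelectionWitness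

open KollarCurveAnyField (insepPoly extField root_pow_eq)

section Plane

variable (k : Type) [Field k] (p : ℕ) [hp : Fact p.Prime]

/-! ### The chart is not geometrically regular: after `t ↦ t^{1/p}`, the point `(T, Y, X) = (0, 0, t^{1/p})` -/

/-- The image of the chart hypersurface over `K = k(t)(t^{1/p})`: `Y T − (X^p − s^p)`. -/
def chartPolyExt : MvPolynomial (Fin 3) (extField k p) :=
  MvPolynomial.map (algebraMap (RatFunc k) (extField k p)) (chartPoly k p)

/-- Explicit form of `chartPolyExt`. -/
theorem chartPolyExt_eq : chartPolyExt k p =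
    MvPolynomial.X 1 * MvPolynomial.X 0 -
      (MvPolynomial.X 2 ^ p - MvPolynomial.C (algebraMap (RatFunc k) (extField k p) RatFunc.X)) := by
  simp [chartPolyExt, chartPoly, MvPolynomial.map_X, MvPolynomial.map_C]

/-- The `K`-point `(0, 0, s)`, `s = t^{1/p}`. -/
def chartCuspPt : Fin 3 → extField k p := ![0, 0, AdjoinRoot.root (insepPoly k p)]

/-- The point lies on the chart hypersurface. -/
theorem eval_chartCuspPt_chartPolyExt : MvPolynomial.eval (chartCuspPt k p) (chartPolyExt k p) = 0 := by
  rw [chartPolyExt_eq]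
  simp [chartCuspPt, root_pow_eq]

/-- All partials vanish there: `∂_T = Y = 0`, `∂_Y = T = 0`, `∂_X = −p X^{p−1} = 0` (`p = 0` in `K`). -/
theorem eval_chartCuspPt_pderiv [CharP k p] (i : Fin 3) :
    MvPolynomial.eval (chartCuspPt k p) (MvPolynomial.pderiv i (chartPolyExt k p)) = 0 := by
  rw [chartPolyExt_eq]
  fin_cases i
  · simp [chartCuspPt, Derivation.leibniz_pow]
  · simp [chartCuspPt, Derivation.leibniz_pow]
  · simp [chartCuspPt, Derivation.leibniz_pow, CharP.cast_eq_zero]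

/-- `chartPolyExt ≠ 0` (it takes the value `1` at `(1, 1, s)`). -/
theorem chartPolyExt_ne_zero : chartPolyExt k p ≠ 0 := by
  intro h
  have := congrArg (MvPolynomial.eval ![1, 1, AdjoinRoot.root (insepPoly k p)]) h
  rw [chartPolyExt_eq] at this
  simp [root_pow_eq] at this

/-- `(chartPolyExt) ≤ ker (eval (0,0,s))`. -/
theorem span_chartPolyExt_le :
    Ideal.span {chartPolyExt k p} ≤ RingHom.ker (MvPolynomial.eval (chartCuspPt k p)) :=
  (Ideal.span_singleton_le_iff_mem _).mpr (eval_chartCuspPt_chartPolyExt k p)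

/-- The point `(0,0,s)` as a prime of the base-changed chart ring. -/
abbrev chartCuspIdeal : Ideal (MvPolynomial (Fin 3) (extField k p) ⧸ Ideal.span {chartPolyExt k p}) :=
  (RingHom.ker (MvPolynomial.eval (chartCuspPt k p))).map (Ideal.Quotient.mk _)

omit hp in
/-- `ker (eval (0,0,s))` is prime. -/
instance ker_eval_chartCuspPt_isPrime : (RingHom.ker (MvPolynomial.eval (chartCuspPt k p))).IsPrime :=
  RingHom.ker_isPrime _

/-- The cusp prime is prime. -/
instance chartCuspIdeal_isPrime : (chartCuspIdeal k p).IsPrime :=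
  Literature.Barriers.ResolutionOfSingularities.isPrime_map_mk_of_le _ _ (span_chartPolyExt_le k p)

/-- Its preimage is `ker (eval (0,0,s))`. -/
theorem comap_chartCuspIdeal :
    (chartCuspIdeal k p).comap (Ideal.Quotient.mk _) = RingHom.ker (MvPolynomial.eval (chartCuspPt k p)) :=
  Literature.Barriers.ResolutionOfSingularities.comap_map_mk_eq_of_le _ _ (span_chartPolyExt_le k p)

/-- **The base-changed chart is NOT regular at `(0, 0, t^{1/p})`** (Jacobian criterion, singular direction). -/
theorem not_isRegularLocalRing_chartCuspIdeal [CharP k p] :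
    ¬ IsRegularLocalRing (Localization.AtPrime (chartCuspIdeal k p)) :=
  not_isRegularLocalRing_localization_of_pderiv_eval_eq_zero (chartCuspPt k p) (chartPolyExt_ne_zero k p)
    (eval_chartCuspPt_chartPolyExt k p) (eval_chartCuspPt_pderiv k p) (chartCuspIdeal k p)
    (comap_chartCuspIdeal k p)

/-! ### The blow-up is not smooth over `k(t)` -/

/-- **The blow-up of `𝔸²_{k(t)}` at the inseparable point is NOT smooth over `k(t)`.** If `Bl ⟶ Spec k(t)` were
smooth, so would be its restriction to the chart `Spec (R[It])_{(Yt)} ≅ Spec k(t)[T,Y,X]/(Y T − (X^p − t))`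
(an open immersion followed by a smooth map), hence the base change of that hypersurface to `K = k(t)(t^{1/p})`
would be regular (Stacks 056S) — but at `(0, 0, t^{1/p})` it is the surface `Y T = (X − t^{1/p})^p`, singular. -/
theorem not_smooth_blowupπ [CharP k p] :
    ¬ Smooth (affineBlowup.π (centre k p) ≫
        Spec.map (CommRingCat.ofHom (algebraMap (RatFunc k) (MvPolynomial (Fin 2) (RatFunc k))))) := by
  intro hsm
  set K := RatFunc k with hK
  set R := MvPolynomial (Fin 2) (RatFunc k) with hR
  set B := MvPolynomial (Fin 3) (RatFunc k) ⧸ Ideal.span {chartPoly k p} with hB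
  have h0 := X_zero_mem_centre k p
  -- the chart and its structure map
  let ι := Proj.awayι (reesGrading (centre k p)) (reesT (MvPolynomial.X 0) h0) (reesT_mem _ h0) one_pos
  have h1 : ι ≫ affineBlowup.π (centre k p) ≫ Spec.map (CommRingCat.ofHom (algebraMap K R)) =
      Spec.map (CommRingCat.ofHom ((reesChartBase (I := centre k p) (MvPolynomial.X 0) h0).comp
        (algebraMap K R))) := by
    rw [← Category.assoc, affineBlowup.awayι_reesT_π, ← Spec.map_comp, ← CommRingCat.ofHom_comp]
  haveI : Smooth (ι ≫ affineBlowup.π (centre k p) ≫ Spec.map (CommRingCat.ofHom (algebraMap K R))) :=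
    inferInstance
  -- transport to the hypersurface model `B`
  have h2 : Spec.map (CommRingCat.ofHom (chartIso k p).toRingHom) ≫
      Spec.map (CommRingCat.ofHom ((reesChartBase (I := centre k p) (MvPolynomial.X 0) h0).comp
        (algebraMap K R))) = Spec.map (CommRingCat.ofHom (algebraMap K B)) := by
    rw [← Spec.map_comp, ← CommRingCat.ofHom_comp]
    congr 2
    ext c
    · exact chartIso_reesChartBase_C k p c
  haveI : IsIso (CommRingCat.ofHom (R := HomogeneousLocalization.Away (reesGrading (centre k p))
      (reesT (MvPolynomial.X 0) h0)) (S := B) (chartIso k p).toRingHom) := by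
    change IsIso (RingEquiv.toCommRingCatIso (R := HomogeneousLocalization.Away (reesGrading (centre k p))
      (reesT (MvPolynomial.X 0) h0)) (S := B) (chartIso k p)).hom
    infer_instance
  haveI hB : Smooth (Spec.map (CommRingCat.ofHom (algebraMap K B))) := by
    rw [← h2, ← h1]
    infer_instance
  -- base change to `K' = k(t)(t^{1/p})`
  let j := Spec.map (CommRingCat.ofHom (algebraMap K (extField k p)))
  have hreg : Scheme.IsRegular (pullback (Spec.map (CommRingCat.ofHom (algebraMap K B))) j) := fun y =>
    isRegularLocalRing_stalk_of_smooth_of_field (pullback.snd (Spec.map (CommRingCat.ofHom (algebraMap K B))) j) y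
  have hreg' : Scheme.IsRegular (Spec (.of (B ⊗[K] extField k p))) :=
    Scheme.IsRegular.of_iso (pullbackSpecIso K B (extField k p)).hom hreg
  -- `B ⊗ K' ≅ K'[T,Y,X]/(chartPolyExt)`
  let e : B ⊗[K] extField k p ≃+* MvPolynomial (Fin 3) (extField k p) ⧸ Ideal.span {chartPolyExt k p} :=
    (Algebra.TensorProduct.comm K B (extField k p)).toRingEquiv.trans
      ((Algebra.TensorProduct.tensorQuotientEquiv (R := K) (extField k p)
          (MvPolynomial (Fin 3) K) (extField k p) (Ideal.span {chartPoly k p})).trans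
        (Ideal.quotientEquivAlg _ _ (MvPolynomial.algebraTensorAlgEquiv K (extField k p)) (by
          rw [Ideal.map_span, Set.image_singleton, Ideal.map_span, Set.image_singleton]
          congr 1
          ext1
          simp [chartPolyExt, Algebra.TensorProduct.includeRight_apply]))).toRingEquiv
  haveI : IsNoetherianRing (B ⊗[K] extField k p) :=
    isNoetherianRing_of_ringEquiv (MvPolynomial (Fin 3) (extField k p) ⧸ Ideal.span {chartPolyExt k p})
      (S := B ⊗[K] extField k p) e.symm
  haveI : IsRegularRing (B ⊗[K] extField k p) :=
    (Scheme.isRegular_Spec_iff (CommRingCat.of (B ⊗[K] extField k p))).mp hreg'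
  haveI : IsRegularRing (MvPolynomial (Fin 3) (extField k p) ⧸ Ideal.span {chartPolyExt k p}) :=
    IsRegularRing.of_ringEquiv (R := B ⊗[K] extField k p) e
  exact not_isRegularLocalRing_chartCuspIdeal k p inferInstance


/-! ### Packaging: a resolution of a smooth surface need not be smooth -/

omit hp in
/-- The plane `𝔸²_{k(t)} ⟶ Spec k(t)` is smooth (polynomial algebras are smooth). [folklore] -/
theorem smooth_plane : Smooth (Spec.map (CommRingCat.ofHom (algebraMap (RatFunc k) (MvPolynomial (Fin 2) (RatFunc k))))) := by
  rw [HasRingHomProperty.Spec_iff (P := @Smooth)]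
  exact RingHom.smooth_algebraMap.mpr (show Algebra.Smooth (RatFunc k) (MvPolynomial (Fin 2) (RatFunc k)) from {})

omit hp in
/-- The plane is locally of finite type over `k(t)`. [folklore] -/
theorem locallyOfFiniteType_plane :
    LocallyOfFiniteType (Spec.map (CommRingCat.ofHom (algebraMap (RatFunc k) (MvPolynomial (Fin 2) (RatFunc k))))) :=
  HasRingHomProperty.Spec_iff.mpr (RingHom.finiteType_algebraMap.mpr inferInstance)

/-- **SELECTION IS NECESSARY (STRATEGY-CENSUS N2 / Disproof §4 (s5), kernel-checked).** For every prime `p` and every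
field `k` of characteristic `p` there are a SMOOTH integral separated `k(t)`-scheme of finite type `X₀` (the plane) and a
resolution of singularities `π : X₁ ⟶ X₀` — proper, birational, `X₁` REGULAR (the blow-up at the inseparable closed point
`(Y, X^p − t)`) — such that `X₁ ⟶ Spec k(t)` is NOT smooth. Hence «some proper birational model smooth over the ground
field» (the conclusion predicate of the W8.2 residual, `CampaignW82.HasSmoothFrobeniusTwistModel` at `e = 0`) cannot be
strengthened to «every resolution», even for a variety that IS smooth: resolutions must be SELECTED. [folklore] -/
theorem exists_resolution_of_smooth_not_smooth [CharP k p] :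
    ∃ (X₀ X₁ : Scheme.{0}) (f₀ : X₀ ⟶ Spec (.of (RatFunc k))) (π : X₁ ⟶ X₀),
      Smooth f₀ ∧ IsSeparated f₀ ∧ LocallyOfFiniteType f₀ ∧ QuasiCompact f₀ ∧ IsIntegral X₀ ∧
        IsResolution π ∧ ¬ Smooth (π ≫ f₀) :=
  ⟨Spec (.of (MvPolynomial (Fin 2) (RatFunc k))), affineBlowup (centre k p),
    Spec.map (CommRingCat.ofHom (algebraMap (RatFunc k) (MvPolynomial (Fin 2) (RatFunc k)))),
    affineBlowup.π (centre k p), smooth_plane k, inferInstance, locallyOfFiniteType_plane k, inferInstance,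
    inferInstance, isResolution_blowupπ k p, not_smooth_blowupπ k p⟩

/-- The same with `HasSmoothProperBirationalModel` spelled out for contrast: the plane HAS a smooth proper birational
model (itself, `π = 𝟙`), yet ADMITS a resolution that is not smooth — existence-only resolution data over `k(t)` does
not control smoothness. [folklore] -/
theorem hasSmoothProperBirationalModel_plane_and_exists_resolution_not_smooth [CharP k p] :
    HasSmoothProperBirationalModel (RatFunc k)
        (Spec.map (CommRingCat.ofHom (algebraMap (RatFunc k) (MvPolynomial (Fin 2) (RatFunc k))))) ∧
      ∃ (X₁ : Scheme.{0}) (π : X₁ ⟶ Spec (.of (MvPolynomial (Fin 2) (RatFunc k)))), IsResolution π ∧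
        ¬ Smooth (π ≫ Spec.map (CommRingCat.ofHom (algebraMap (RatFunc k) (MvPolynomial (Fin 2) (RatFunc k))))) := by
  refine ⟨⟨_, 𝟙 _, inferInstance, ⟨⊤, by simp, by simp, inferInstance⟩, ?_⟩,
    affineBlowup (centre k p), affineBlowup.π (centre k p), isResolution_blowupπ k p, not_smooth_blowupπ k p⟩
  rw [Category.id_comp]
  exact smooth_plane k

end Plane

end Summit.ResolutionOfSingularities.ResolutionOfSingularities.Theorems.CampaignW82.SelectionWitness

end
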